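import Summits.HubbardSuperconductivity.HubbardSuperconductivity.Theses.RvbParentAnchor
import Summits.HubbardSuperconductivity.HubbardSuperconductivity.Theorems.TwTipContinuation.Negative.TipNormalForm
import Literature.MathematicalPhysics.QuantumLattice.SectorEigenvalueContinuation
import Literature.MathematicalPhysics.QuantumLattice.SectorSpectrum
import Literature.MathematicalPhysics.QuantumLattice.FinDimSpectrumSectorGibbsLimit
import Literature.MathematicalPhysics.QuantumLattice.HubbardRingPerronFrobeniusProofs
import Literature.MathematicalPhysics.QuantumLattice.HubbardWave0LiebProofs
import Literature.Barriers.HubbardSuperconductivity.PureModelStripeCompetitionProofs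

/-!
# Route `RvbParentAnchor` — `EndpointTransfer` and the assembly

* `endpoint_core`: the finite-dimensional **endpoint transfer**. Let `H` be Hermitian with a
  normalised ground state `ψ` in a subspace `K` (eigenvalue the sector energy `m`, variational
  principle on `K`) which is simple (every sector ground state is proportional to `ψ`); suppose
  that for every `s > 0` the perturbed matrix `H + sP` has a normalised sector ground state, obeys
  the variational principle on `K`, and every such ground state `v` has `c ≤ Re⟨v, D v⟩`. Then
  `c ≤ Re⟨ψ, D ψ⟩`. Proof: take `s = 1/(k+1)` and ground states `v_k`; they lie on the compact
  unit sphere of `K`, so a subsequence converges to a unit `w ∈ K`; the sector energies `E_k` of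
  `H + s_k P` are squeezed to `m` (`s_k · min Re⟨·,P·⟩ ≤ E_k - m ≤ s_k · Re⟨ψ,Pψ⟩`), hence
  `H w = m w` in the limit; by simplicity `ψ = a • w` with `|a| = 1`, and the continuous quadratic
  form of `D` passes the floor to `w`, hence to `ψ`.
* `EndpointTransfer` (stmt-HubbardSuperconductivity-2656): the route's endpoint bookkeeping — the
  core at every large even side (sector ground states of `H + sP` exist by `sector_groundState`,
  the sector being a coordinate subspace preserved by `H` and by `P`), then the even-side
  `liminf` bookkeeping with the a-priori cap.
* `Assembly` (stmt-HubbardSuperconductivity-2657): `AnchorExists → PathLRO → HubbardSuperconductivity`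
  via `EndpointTransfer` (the anchor is not consumed).

Sources: T. Kato, *Perturbation Theory for Linear Operators* (1966), Ch. II §5 (continuity of
eigenprojections in finite dimension — context); E. H. Lieb, F. Y. Wu, Physica A 321 (2003) 1, §2
(uniqueness of the ground state along a parameter); D. J. Scalapino, Phys. Rep. 250 (1995) 329, §2.
No new definitions.
-/

-- the mandated namespace `Summit.<Summit>.<Problem>.Theorems` repeats `HubbardSuperconductivity`
-- (single-problem summit, D-0017), which the `dupNamespace` linter flags on every declaration
set_option linter.dupNamespace false

namespace Summit.HubbardSuperconductivity.HubbardSuperconductivity.Theorems.RvbParentAnchor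

open Matrix Filter Topology Literature.MathematicalPhysics.QuantumLattice Literature.Probability.LatticeModels
open Literature.MathematicalPhysics.QuantumLattice.EigenvalueContinuation
  (isCompact_unitSphere_inter continuous_energy)
open Summit.HubbardSuperconductivity.HubbardSuperconductivity.Theses.RvbParentAnchor
open Summit.HubbardSuperconductivity.TwTipContinuation.Negative
  (lroTerm_eq expect_pairIntensity_le side_pow_pos)

section Core

variable {ι : Type*} [Fintype ι]

/-- Energy of a scalar multiple: `Re⟨c•v, A (c•v)⟩ = |c|² Re⟨v, A v⟩`. [folklore] -/
theorem re_energy_smul (A : Matrix ι ι ℂ) (c : ℂ) (v : ι → ℂ) :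
    (star (c • v) ⬝ᵥ A *ᵥ (c • v)).re = ‖c‖ ^ 2 * (star v ⬝ᵥ A *ᵥ v).re := by
  rw [mulVec_smul, star_smul, smul_dotProduct, dotProduct_smul, smul_eq_mul, smul_eq_mul,
    ← mul_assoc, Complex.star_def, Complex.conj_mul', ← Complex.ofReal_pow, Complex.re_ofReal_mul]

/-- Norm of a scalar multiple: `⟨c•v, c•v⟩ = |c|² ⟨v, v⟩` (real parts). [folklore] -/
theorem re_norm_smul (c : ℂ) (v : ι → ℂ) :
    (star (c • v) ⬝ᵥ (c • v)).re = ‖c‖ ^ 2 * (star v ⬝ᵥ v).re := by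
  rw [star_smul, smul_dotProduct, dotProduct_smul, smul_eq_mul, smul_eq_mul,
    ← mul_assoc, Complex.star_def, Complex.conj_mul', ← Complex.ofReal_pow, Complex.re_ofReal_mul]

/-- A matrix mapping a coordinate subspace into itself has no entries from the subspace's
coordinates to the others. [folklore] -/
theorem apply_eq_zero_of_mapsTo [DecidableEq ι] {A : Matrix ι ι ℂ} (p : ι → Prop)
    (K : Submodule ℂ (ι → ℂ))
    (hK : ∀ v, v ∈ K ↔ ∀ i, ¬ p i → v i = 0) (hmap : ∀ v ∈ K, A *ᵥ v ∈ K) :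
    ∀ i j, ¬ p i → p j → A i j = 0 := by
  intro i j hi hj
  have hj' : (Pi.single j (1 : ℂ) : ι → ℂ) ∈ K := by
    refine (hK _).2 fun i' hi' => ?_
    rw [Pi.single_apply, if_neg]
    rintro rfl
    exact hi' hj
  have h := (hK _).1 (hmap _ hj') i hi
  rwa [mulVec_single_one] at h

/-- **Endpoint transfer (finite-dimensional core).** See the module docstring. Kato (1966) II §5;
Lieb–Wu (2003) §2. [folklore] -/
theorem endpoint_core (H P D : Matrix ι ι ℂ) (K : Submodule ℂ (ι → ℂ)) (ψ : ι → ℂ)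
    (hψK : ψ ∈ K) (hψ1 : star ψ ⬝ᵥ ψ = 1)
    (hHψ : H *ᵥ ψ = ((H.minEnergyOn K : ℝ) : ℂ) • ψ)
    (hvar : ∀ v ∈ K, star v ⬝ᵥ v = 1 → H.minEnergyOn K ≤ (star v ⬝ᵥ H *ᵥ v).re)
    (huniq : ∀ φ ∈ K, φ ≠ 0 → H *ᵥ φ = ((H.minEnergyOn K : ℝ) : ℂ) • φ → ∃ a : ℂ, ψ = a • φ)
    (hGS : ∀ s : ℝ, 0 < s → ∃ v ∈ K, star v ⬝ᵥ v = 1 ∧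
      (H + (s : ℂ) • P) *ᵥ v = (((H + (s : ℂ) • P).minEnergyOn K : ℝ) : ℂ) • v)
    (hvarS : ∀ s : ℝ, 0 < s → ∀ v ∈ K, star v ⬝ᵥ v = 1 →
      (H + (s : ℂ) • P).minEnergyOn K ≤ (star v ⬝ᵥ (H + (s : ℂ) • P) *ᵥ v).re)
    {c : ℝ} (hfloor : ∀ s : ℝ, 0 < s → ∀ v ∈ K, star v ⬝ᵥ v = 1 →
      (H + (s : ℂ) • P) *ᵥ v = (((H + (s : ℂ) • P).minEnergyOn K : ℝ) : ℂ) • v →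
        c ≤ (star v ⬝ᵥ D *ᵥ v).re) :
    c ≤ (star ψ ⬝ᵥ D *ᵥ ψ).re := by
  classical
  set m : ℝ := H.minEnergyOn K with hm
  -- the compact unit sphere of `K`
  set C : Set (ι → ℂ) := {u | u ∈ K ∧ star u ⬝ᵥ u = 1} with hC
  have hCc : IsCompact C := isCompact_unitSphere_inter K
  have hψC : ψ ∈ C := ⟨hψK, hψ1⟩
  -- bounds for `Re⟨u, P u⟩` on `C`
  obtain ⟨uhi, -, hhi⟩ := hCc.exists_isMaxOn ⟨ψ, hψC⟩ (continuous_energy P).continuousOn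
  obtain ⟨ulo, -, hlo⟩ := hCc.exists_isMinOn ⟨ψ, hψC⟩ (continuous_energy P).continuousOn
  set Bhi : ℝ := (star uhi ⬝ᵥ P *ᵥ uhi).re
  set Blo : ℝ := (star ulo ⬝ᵥ P *ᵥ ulo).re
  -- the sequence of perturbed ground states
  set sq : ℕ → ℝ := fun k => 1 / ((k : ℝ) + 1) with hsq
  have hsq_pos : ∀ k, 0 < sq k := fun k => by positivity
  have hsq0 : Tendsto sq atTop (𝓝 0) := tendsto_one_div_add_atTop_nhds_zero_nat
  choose v hvK hv1 hveig using fun k => hGS (sq k) (hsq_pos k)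
  set E : ℕ → ℝ := fun k => (H + ((sq k : ℝ) : ℂ) • P).minEnergyOn K with hE
  -- energy identities
  have hsplit : ∀ (s : ℝ) (u : ι → ℂ), (star u ⬝ᵥ (H + (s : ℂ) • P) *ᵥ u).re =
      (star u ⬝ᵥ H *ᵥ u).re + s * (star u ⬝ᵥ P *ᵥ u).re := by
    intro s u
    rw [add_mulVec, dotProduct_add, Complex.add_re, smul_mulVec, dotProduct_smul,
      smul_eq_mul, Complex.re_ofReal_mul]
  have hEψ : (star ψ ⬝ᵥ H *ᵥ ψ).re = m := by
    rw [hHψ, dotProduct_smul, hψ1, smul_eq_mul, mul_one, Complex.ofReal_re]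
  have hEv : ∀ k, (star (v k) ⬝ᵥ (H + ((sq k : ℝ) : ℂ) • P) *ᵥ v k).re = E k := by
    intro k
    rw [hveig, dotProduct_smul, hv1, smul_eq_mul, mul_one, Complex.ofReal_re]
  -- squeeze: `sq k * Blo ≤ E k - m ≤ sq k * Bhi`
  have hup : ∀ k, E k - m ≤ sq k * Bhi := by
    intro k
    have h1 := hvarS (sq k) (hsq_pos k) ψ hψK hψ1
    rw [hsplit, hEψ] at h1
    have h2 : (star ψ ⬝ᵥ P *ᵥ ψ).re ≤ Bhi := hhi hψC
    nlinarith [hsq_pos k]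
  have hdown : ∀ k, sq k * Blo ≤ E k - m := by
    intro k
    have h1 := hvar (v k) (hvK k) (hv1 k)
    have h3 := hEv k
    rw [hsplit] at h3
    have h2 : Blo ≤ (star (v k) ⬝ᵥ P *ᵥ v k).re := hlo ⟨hvK k, hv1 k⟩
    nlinarith [hsq_pos k]
  have hEm : Tendsto E atTop (𝓝 m) := by
    have hsub : Tendsto (fun k => E k - m) atTop (𝓝 0) := by
      refine tendsto_of_tendsto_of_tendsto_of_le_of_le (f := fun k => E k - m) ?_ ?_ hdown hup
      · simpa using hsq0.mul_const Blo
      · simpa using hsq0.mul_const Bhi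
    have := hsub.add_const m
    simpa using this
  -- a convergent subsequence on the compact unit sphere
  obtain ⟨w, hwC, φ, hφ, hconv⟩ := tendsto_subseq_of_bounded hCc.isBounded (x := v)
    fun k => (⟨hvK k, hv1 k⟩ : v k ∈ C)
  rw [hCc.isClosed.closure_eq] at hwC
  obtain ⟨hwK, hw1⟩ := hwC
  have hw0 : w ≠ 0 := by
    intro h; rw [h, dotProduct_zero] at hw1; exact zero_ne_one hw1
  -- the limit is a sector ground state of `H`
  have hmul : ∀ A : Matrix ι ι ℂ, Tendsto (fun k => A *ᵥ v (φ k)) atTop (𝓝 (A *ᵥ w)) := by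
    intro A
    have hc : Continuous fun u : ι → ℂ => A *ᵥ u :=
      (Matrix.mulVecLin A).continuous_of_finiteDimensional
    exact (hc.tendsto w).comp hconv
  have hHw : H *ᵥ w = (m : ℂ) • w := by
    have h1 : ∀ k, H *ᵥ v (φ k) =
        ((E (φ k) : ℝ) : ℂ) • v (φ k) - ((sq (φ k) : ℝ) : ℂ) • (P *ᵥ v (φ k)) := by
      intro k
      have h := hveig (φ k)
      rw [add_mulVec, smul_mulVec] at h
      exact eq_sub_of_add_eq h
    have h2 : Tendsto (fun k => ((E (φ k) : ℝ) : ℂ) • v (φ k) -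
        ((sq (φ k) : ℝ) : ℂ) • (P *ᵥ v (φ k))) atTop (𝓝 ((m : ℂ) • w - (0 : ℂ) • (P *ᵥ w))) := by
      refine Tendsto.sub (Tendsto.smul ?_ hconv) (Tendsto.smul ?_ (hmul P))
      · exact (Complex.continuous_ofReal.tendsto m).comp (hEm.comp hφ.tendsto_atTop)
      · exact (Complex.continuous_ofReal.tendsto 0).comp (hsq0.comp hφ.tendsto_atTop)
    rw [zero_smul, sub_zero] at h2
    exact tendsto_nhds_unique ((hmul H).congr h1) h2
  -- the floor passes to the limit
  have hfl : c ≤ (star w ⬝ᵥ D *ᵥ w).re := by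
    refine ge_of_tendsto (((continuous_energy D).tendsto w).comp hconv)
      (Eventually.of_forall fun k => ?_)
    exact hfloor (sq (φ k)) (hsq_pos _) (v (φ k)) (hvK _) (hv1 _) (hveig _)
  -- simplicity: `ψ = a • w` with `|a| = 1`
  obtain ⟨a, ha⟩ := huniq w hwK hw0 hHw
  have ha1 : ‖a‖ ^ 2 = 1 := by
    have h := re_norm_smul a w
    rw [← ha, hψ1, hw1, Complex.one_re, mul_one] at h
    exact h.symm
  rw [ha, re_energy_smul, ha1, one_mul]
  exact hfl

end Core

/-- **`EndpointTransfer`** (stmt-HubbardSuperconductivity-2656): the route's endpoint bookkeeping.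
At every even side `L = 2k ≥ L₁` the sector `(N_L, S^z = 0)` is a coordinate subspace preserved
by `hubbardTorus 2 L 1 U` and by `P_L`, so `H + sP_L` has normalised sector ground states for every
`s > 0` (`sector_groundState`), and `endpoint_core` (compactness of the unit sphere of the sector,
squeeze of the sector energies, simplicity of the Hubbard sector ground state) transfers the floor
`c'L⁴ ≤ Re⟨Δ_d†Δ_d⟩` from those ground states to the given `ψ_L`; the even-side `liminf`
bookkeeping (a-priori cap `expect_pairIntensity_le`) then gives `HasLongRangeOrder`.
Kato (1966) II §5; Scalapino, Phys. Rep. 250 (1995) 329, §2. [folklore] -/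
theorem endpointTransfer_proof :
    Summit.HubbardSuperconductivity.HubbardSuperconductivity.Theses.RvbParentAnchor.EndpointTransfer := by
  classical
  intro U δ c' P hU hδ hc' hPath N ψ hyp
  obtain ⟨L₁, hP⟩ := hPath
  -- the floor at every large even side
  have hfloorL : ∀ (L : ℕ) [NeZero L], Even L → L₁ ≤ L →
      c' * (L : ℝ) ^ 4 ≤ (expect ((pairField dWaveFormFactor L)ᴴ * pairField dWaveFormFactor L)
        (ψ L)).re := by
    intro L _ hE hL
    obtain ⟨hPh, hPmap, hfl, hsimp⟩ := hP L hE hL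
    obtain ⟨hN, hu, hgs⟩ := hyp L hE
    rw [hN] at hgs
    set n : ℕ := ⌊(1 - δ) * (L : ℝ) ^ 2 / 2⌋₊ with hn
    set K := szSector (Λ := FermionTorus 2 L) (2 * n) 0 with hK
    set H := hubbardTorus 2 L 1 U with hH
    have hHerm : H.IsHermitian := hubbardTorus_isHermitian (hamiltonian_isHermitian_and_commute_holds _) 1 U
    -- the sector as a coordinate subspace, preserved by `H` and `P L`
    have hKmem : ∀ v : Fock (Orb (FermionTorus 2 L)), v ∈ K ↔
        ∀ s, ¬((upPart s).card = n ∧ (downPart s).card = n) → v s = 0 :=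
      fun v => mem_szSector_two_mul_zero_iff n v
    have hHinv : ∀ s s' : Finset (Orb (FermionTorus 2 L)),
        ¬((upPart s).card = n ∧ (downPart s).card = n) →
        ((upPart s').card = n ∧ (downPart s').card = n) → H s s' = 0 := by
      intro s s' hs hs'
      by_contra h
      have := LiebThm1.preservesSectors_hamiltonian (fermionTorusGraph 2 L) 1 U s s' h
      exact hs ⟨this.1.trans hs'.1, this.2.trans hs'.2⟩
    have hPinv := apply_eq_zero_of_mapsTo (A := P L)
      (fun s : Finset (Orb (FermionTorus 2 L)) => (upPart s).card = n ∧ (downPart s).card = n) K hKmem hPmap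
    have hn2 : n ≤ L ^ 2 := Literature.Barriers.HubbardSuperconductivity.natFloor_filling_le_sq
      (by linarith [hδ.1]) L
    have hp : ∃ s : Finset (Orb (FermionTorus 2 L)), (upPart s).card = n ∧ (downPart s).card = n := by
      have hcard : n ≤ Fintype.card (FermionTorus 2 L) := by
        rwa [Summit.HubbardSuperconductivity.NoGo.card_fermionTorus_two]
      obtain ⟨α₀, -, hα₀⟩ : ∃ α₀ : Finset (FermionTorus 2 L), α₀ ⊆ Finset.univ ∧ α₀.card = n :=
        Finset.exists_subset_card_eq (by rwa [Finset.card_univ])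
      exact ⟨pairSet α₀ α₀, by rw [upPart_pairSet, hα₀], by rw [downPart_pairSet, hα₀]⟩
    -- perturbed ground states and variational principles
    have hAS : ∀ s : ℝ, (H + (s : ℂ) • P L).IsHermitian := fun s =>
      hHerm.add (hPh.smul (by rw [isSelfAdjoint_iff, Complex.star_def, Complex.conj_ofReal]))
    have hGS : ∀ s : ℝ, 0 < s → ∃ v ∈ K, star v ⬝ᵥ v = 1 ∧
        (H + (s : ℂ) • P L) *ᵥ v = (((H + (s : ℂ) • P L).minEnergyOn K : ℝ) : ℂ) • v := by
      intro s _
      have hinv : ∀ t t' : Finset (Orb (FermionTorus 2 L)),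
          ¬((upPart t).card = n ∧ (downPart t).card = n) →
          ((upPart t').card = n ∧ (downPart t').card = n) → (H + (s : ℂ) • P L) t t' = 0 := by
        intro t t' ht ht'
        rw [Matrix.add_apply, Matrix.smul_apply, hHinv t t' ht ht', hPinv t t' ht ht', smul_zero,
          add_zero]
      obtain ⟨⟨v, hvK, hv0, hAv⟩, -⟩ := sector_groundState (H + (s : ℂ) • P L) (hAS s)
        (fun t => (upPart t).card = n ∧ (downPart t).card = n) hp hinv K hKmem
      obtain ⟨a, -, ha1⟩ := exists_smul_unit hv0
      refine ⟨a • v, K.smul_mem a hvK, ha1, ?_⟩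
      rw [mulVec_smul, hAv, smul_comm]
    have hvar : ∀ v ∈ K, star v ⬝ᵥ v = 1 → H.minEnergyOn K ≤ (star v ⬝ᵥ H *ᵥ v).re :=
      fun v hv h1 => minEnergyOn_le_rayleigh_of_mem hHerm K hv h1
    have hvarS : ∀ s : ℝ, 0 < s → ∀ v ∈ K, star v ⬝ᵥ v = 1 →
        (H + (s : ℂ) • P L).minEnergyOn K ≤ (star v ⬝ᵥ (H + (s : ℂ) • P L) *ᵥ v).re :=
      fun s _ v hv h1 => minEnergyOn_le_rayleigh_of_mem (hAS s) K hv h1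
    have huniq : ∀ φ ∈ K, φ ≠ 0 → H *ᵥ φ = ((H.minEnergyOn K : ℝ) : ℂ) • φ →
        ∃ a : ℂ, ψ L = a • φ :=
      fun φ hφK hφ0 hHφ => hsimp φ (ψ L) ⟨hφK, hφ0, hHφ⟩ hgs
    have hfloor : ∀ s : ℝ, 0 < s → ∀ v ∈ K, star v ⬝ᵥ v = 1 →
        (H + (s : ℂ) • P L) *ᵥ v = (((H + (s : ℂ) • P L).minEnergyOn K : ℝ) : ℂ) • v →
          c' * (L : ℝ) ^ 4 ≤ (star v ⬝ᵥ ((pairField dWaveFormFactor L)ᴴ *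
            pairField dWaveFormFactor L) *ᵥ v).re := by
      intro s hs v hvK hv1 hveig
      have hv0 : v ≠ 0 := by
        intro h; rw [h, dotProduct_zero] at hv1; exact zero_ne_one hv1
      exact hfl s hs v ⟨hvK, hv0, hveig⟩ hv1
    exact endpoint_core H (P L) _ K (ψ L) hgs.1 hu hgs.2.2 hvar huniq hGS hvarS hfloor
  -- the even-side `liminf` bookkeeping
  change 0 < liminf (fun k : ℕ => (∑ x ∈ halfOpenBox 2 (2 * k), ∑ y ∈ halfOpenBox 2 (2 * k),
          torusPullback (pairFieldCorr dWaveFormFactor ψ) (2 * k) x y) /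
        ((halfOpenBox 2 (2 * k)).card : ℝ) ^ 2) atTop
  have hev : ∀ᶠ k in atTop, c' ≤ (∑ x ∈ halfOpenBox 2 (2 * k), ∑ y ∈ halfOpenBox 2 (2 * k),
          torusPullback (pairFieldCorr dWaveFormFactor ψ) (2 * k) x y) /
        ((halfOpenBox 2 (2 * k)).card : ℝ) ^ 2 := by
    refine eventually_atTop.2 ⟨L₁ + 1, fun k hk => ?_⟩
    haveI : NeZero (2 * k) := ⟨by omega⟩
    rw [lroTerm_eq, le_div_iff₀ (side_pow_pos k)]
    exact hfloorL (2 * k) (even_two_mul k) (by omega)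
  have hev' : ∀ᶠ k in atTop, (∑ x ∈ halfOpenBox 2 (2 * k), ∑ y ∈ halfOpenBox 2 (2 * k),
          torusPullback (pairFieldCorr dWaveFormFactor ψ) (2 * k) x y) /
        ((halfOpenBox 2 (2 * k)).card : ℝ) ^ 2 ≤
      (∑ e ∈ insert 0 unitSteps, ‖((dWaveFormFactor e / Real.sqrt 2 : ℝ) : ℂ)‖ * 2) ^ 2 := by
    refine eventually_atTop.2 ⟨1, fun k hk => ?_⟩
    haveI : NeZero (2 * k) := ⟨by omega⟩
    obtain ⟨-, hu, -⟩ := hyp (2 * k) (even_two_mul k)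
    rw [lroTerm_eq, div_le_iff₀ (side_pow_pos k)]
    exact expect_pairIntensity_le (2 * k) (ψ (2 * k)) hu
  exact lt_of_lt_of_le hc' (le_liminf_of_le (isCoboundedUnder_ge_of_eventually_le _ hev') hev)

/-- **Assembly of route `RvbParentAnchor`** (stmt-HubbardSuperconductivity-2657):
`AnchorExists → PathLRO → HubbardSuperconductivity` — the path LRO supplies `δ`, the family `P`,
`U > 0`, `c' > 0` and the path data, which `endpointTransfer_proof` turns into the summit's matrix
at `(U, δ)` (the anchor is not consumed). Scalapino, Phys. Rep. 250 (1995) 329, §2. [folklore] -/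
theorem rvbParentAnchor_assembly_proof :
    Summit.HubbardSuperconductivity.HubbardSuperconductivity.Theses.RvbParentAnchor.Assembly := by
  intro _hA hP
  obtain ⟨δ, hδ, _c, _hc, _r, _L₀, P, _hanchor, U, hU, c', hc', hpath⟩ := hP
  exact ⟨U, hU, δ, hδ, endpointTransfer_proof U δ c' P hU hδ hc' hpath⟩

end Summit.HubbardSuperconductivity.HubbardSuperconductivity.Theorems.RvbParentAnchor
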